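import Literature.MathematicalPhysics.QuantumFieldTheory.Balaban1983to89.B7Prop2Explicit
import Literature.MathematicalPhysics.QuantumFieldTheory.Balaban1983to89.BlockAveragingExpMeanLog

/-!
# Bałaban's renormalization group for 4-d lattice Yang–Mills — B7 Proposition 2 (52)–(54) for the paper's gauge
group "a Lie subgroup `G` of a unitary group `U(N)`" in the case `G = SU(N)`: the tacit `G`-valuedness of the averages
(42)/(43) holds at a `G`-DEPENDENT radius (`|W − 1| ≤ t ≤ 1/4`, `Nt < π`) and FAILS at the `N`-independent one
(`t ≥ 2π/N`); Prop. 2 PROVED for `SU(N)`-valued configurations with `c₂′ = c₂′(d, L, SU(N))` (`B7Prop2SpecialUnitary`)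

CITATION HEADER (lean-in-tree rule 2026-08-18).  Audit cell `pub-balaban`, paper sub-cell B07 (unit b2b-balaban-b07,
gen 15).  Source: T. Bałaban, *Averaging operations for lattice gauge theories*, Commun. Math. Phys. **98**, 17–51
(1985) [Balaban1985Averaging] (cell paper B7; journal page = PDF page + 16), pp. 18–21, 23, 26 [PDF 2–5, 7, 10]; the
renders `b2b-balaban-ref1/pages/1985-cmp98-averaging/1985-cmp98-averaging-p003-x2.png`, `-p004`, `-p005`, `-p010-x2.png`
(pp. 19, 20, 21, 26) were READ AS IMAGES for this file; the quotations of pp. 17–18, 23–25 are carried verbatim from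
the headers of the companions `B7Prop1Explicit` (gen 13) and `B7Prop2Explicit` (gen 14), which read `-p001`, `-p002`,
`-p007`–`-p009-x2.png` as images.  Companions, used BY NAME: `B7Prop2Explicit` (gen 14: Prop. 2 for `AvgClosed`
groups — closure of `G` under (42) at the radius `1/4` — and for `U(N)`; THIS FILE makes the closure radius a
parameter `t` and instantiates it for `SU(N)`: `AvgClosed`, `avgIter`, `pdev`, `le_pdev`, `pdev_nonneg`, `rescale`,
`step_avgIter`, `bound53_le`, `norm_Wcx_sub_one_le`, `concreteKStep`, `unitaryUnits`, `bavg_mem_unitaryUnits`,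
`unitaryUnits_le_U1`, `hol_mem_of`), `B7Prop1Explicit` (gen 13: `Site`, `e`, `Letter`, `hol`, `stepHol`, `seg`,
`plaqWord`, `gammaWord`, `boxVec`, `Wcx`, `Xavg`, `bavg`, `expUnit`, `U1`, `C0`, `c2'`), `B7` (the quoted leaf
`B7.Prop2Printed`, the carrier `B7.KStep`, and the kernel arithmetic of (53)–(54): `B7.ineq53_induction`,
`B7.prop2_of_ineq53`, `B7.geom_bracket_le_two`, `B7.prop2_ratio_lt_half`, `B7.prop2_bound_lt_two_alpha`),
`BlockAveragingExpMeanLog` (namespace `ExpMeanLog`, cell unit pub-verify-11: `trace_mlog_eq_zero` — `Tr log W = 0`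
for `W ∈ SU(N)`, `|W − 1| ≤ ⅓`, `N|W − 1| < π`, from `det e^X = e^{Tr X}`
(`Literature.Analysis.Matrix.det_exp_eq_exp_trace`) and (26) — and `exp_smul_one_eq`), `MatrixLog` ((21): `mlog`,
`mlog_one`), `B7BlockAvgLog` (`mlog_exp`: `log ∘ exp = id` on `|C| < ln 2`), Mathlib (`Matrix.specialUnitaryGroup`,
`Matrix.det_smul`, `Complex.exp_two_pi_mul_I`, `Complex.exp_pi_mul_I`, `Real.norm_exp_I_mul_ofReal_sub_one_le`,
`Unitary.star_mul_self_of_mem`; the C⋆-algebra structure of `M_N(ℂ)` with the operator norm, scope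
`Matrix.Norms.L2Operator`).  No hypothesis of any theorem below is a cited fact: everything is kernel-proved.

THE PRINTED TEXT.  p. 18 [PDF 2]: "Gauge field configurations `U` are defined on a set of bonds in `Ω`, and with
values in a Lie subgroup `G` of a unitary group `U(N)`."  p. 19 [PDF 3]: "`ρ′(V) = ∫ dU δ(VŪ⁻¹)ρ(U)`, (10) where, for
example, `U` is a gauge field configuration on the lattice `Ω^{(j)}`, `V` is a configuration on the lattice `Ω^{(j+1)}`
and `dU` is a product of Haar measures of the group `G`. The most important part of the above definition is an
averaging operation `Ū`. It transforms a configuration `U` defined on `Ω^{(j)}` into a configuration `Ū` defined on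
`Ω^{(j+1)}`. … We consider configurations `U` with values in a small neighborhood of the identity of `G`, hence `U =
e^{iA}` and `A` is a Lie algebra valued configuration with values in a small neighborhood of `0`. … We define `Ū_c =
exp[i Σ_{x∈B(c₋)} L^{−d} (1/i) log U(Γ_{c,x})U(c)⁻¹] U(c)`. (15)"  p. 20 [PDF 4], Sect. A: "We consider a Lie subgroup
`G` of a unitary group `U(N)`. Its Lie algebra `𝔤` is a subalgebra of the algebra of hermitian matrices. … The unitary
group `U(N)` can be obtained by an application of the exponential mapping to the algebra of hermitian matrices. This
exponential mapping is simply given by the exponential function `e^{iA}`, where `e^X = exp X = Σ_{n=0}^∞ X^n/n!` (16)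
is defined for an arbitrary matrix `X`. The group `G` is obtained by applying the function `e^{iA}` to `A ∈ 𝔤`, and
the complexified group `G^c` may be defined as an image of the exponential function applied to the complexified
algebra `𝔤^c`. … We will need only a neighborhood of `G` in this subgroup. We introduce a scalar product in the algebra
of all complex matrices `⟨X, Y⟩ = tr X*Y`, `tr X = (1/N) Σ_{j=1}^N X_{j,j}` (17)".  p. 21 [PDF 5]: "It is the operator
norm given by `|X| = sup |Xψ|` … (19) We have the following inequalities for the norms introduced: `|tr X| ≤ |X|`,
`‖X‖ ≤ |X|`, `|X| ≤ √N‖X‖`, `|XY| ≤ |X||Y|`, `‖XY‖ ≤ ‖X‖‖Y‖`. (20) … The first is a logarithmic function. It is an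
inverse to the exponential function and for matrices `X` satisfying `|X − 1| < 1` it is given by `log X = Σ_{n=1}^∞
((−1)^{n+1}/n)(X − 1)^n`. (21) … We will use this definition for `log z = log|z| + i arg z`, where `arg z ∈ ]−π, π]`,
and for unitary matrices. Every unitary matrix `U` can be represented uniquely in the form `U = Σ_j e^{iλ_j}P_j`,
where the numbers `λ_j` are different and satisfy `λ_j ∈ ]−π, π]`, and then we define `log U = i Σ_j λ_jP_j = iA`,
(23) `A` is a hermitian matrix, `|A| ≤ π`. From this definition the following inequalities follow: `|U − 1| = max_j
|e^{iλ_j} − 1| = max_j |sin(λ_j/2)/(λ_j/2)| |λ_j| ≤ max_j |λ_j| = |log U|, (24) `|log U| ≤ (π/2)|U − 1|` … (25)".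
p. 23 [PDF 7], Sect. B: "Let us recall the basic definitions. Let `U` be a gauge field configuration with values in
`U(N)`. The one-step averaging operation is defined by `Ū_c = exp[i Σ_{x∈B(c₋)} L^{−d} (1/i) log U(Γ_{c,x}) U(c)⁻¹]
U(c)`, `c ⊂ Ω^{(1)}`, (42)" (and (43), the `k`-fold average, p. 24 — see the header of `B7Prop2Explicit`).  p. 26
[PDF 10]: "**Proposition 1.** There exist positive constants `C₀, c₂′` such that for every configuration `V`
satisfying (44) for `p ⊂ Δ(p′)` and for `α₀ ≤ c₂′`, we have `|V̄(∂p′) − 1| < L²α₀ + C₀(L²α₀)²`. (51) The constant `C₀`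
depends on `d` and `c₂′` depends on `d` and `L`."; "… we have to assume that `|U(∂p) − 1| < α₀η²`, `η = L^{−k}` (52)
on some set of plaquettes. … We assume further that `2α₀ ≤ c₂′`. Then for `j < k`, we can apply Proposition 1 to the
configuration `Ū^j` and we get for `p ⊂ Ω^{(j+1)}` … Thus the inequality (53) is proved for all `j ≤ k`. Taking `j =
k`, we get **Proposition 2.** If `U` satisfies (52) with `α₀ ≤ c₂ = min{1/(3C₀), ½c₂′}`, then `|Ū^k(∂p) − 1| < α₀ +
2C₀α₀² < 2α₀`, `p ⊂ Ω^{(k)}`. (54)" (the full p. 26 text is quoted in the header of `B7Prop2Explicit`).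

DICTIONARY print ↦ Lean (this namespace; all objects of `B7Prop1Explicit` / `B7Prop2Explicit` re-used, see their
DICTIONARY: `Ω^{(j)} ≅ ℤ^d = Site d`, (9) `hol`, `∂p ↦ plaqWord`, (42) ↦ `bavg L V` with exponent `Xavg` and
`log`-arguments `W_x = V(Γ_{c,x})V(c)⁻¹ ↦ Wcx`, (43) ↦ `avgIter L V k`, `sup_p |·(∂p) − 1| ↦ pdev`, (52) ↦ `pdev V <
α₀((L^k)⁻¹)²`, `C₀ = C0 d = 14464(d+1)²(d+4)²`, `c₂′ = c2' d L = 1/(512(d+1)(d+4)L²)`).  NEW: `G = SU(N)` ↦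
`specialUnitaryUnits (Fin N)`, the units of `M_N(ℂ)` whose value lies in Mathlib's `Matrix.specialUnitaryGroup`
(`uu⋆ = u⋆u = 1 ∧ det u = 1`); `|·|` (19) ↦ the operator-norm instance of the scope `Matrix.Norms.L2Operator`; `tr`
(17) is the normalised trace `(1/N)Σ X_jj` — Lean uses Mathlib's `Matrix.trace = Σ X_jj`; only "`Tr log W = 0`" and
`det e^X = e^{Tr X}` occur, both insensitive to the normalisation; `log` ↦ the series (21) `MatrixLog.mlog`, which on
`|X − 1| < 1` inverts `exp` (`MatrixLog.exp_mlog`, `B7BlockAvgLog.mlog_exp` — the only two properties used below;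
all arguments have `|W − 1| ≤ 1/4`) and, for normal `X`, coincides there with the principal-branch spectral definition
(22)–(23) (classical — the Mercator series converges to the principal branch on `|z − 1| < 1` — and not needed); the
property left tacit on pp. 19,
23–24, 26 — "`Ū` is again a (`G`-valued) configuration", i.e. (42)/(43) are `G`-valued, needed to "apply Proposition
1 to the configuration `Ū^j`" and for (10) — ↦ `AvgClosedAt d t L G` (closure of `G` under (42) at every `L`-bond whose
`log`-arguments are within `t` of `1`; `B7Prop2Explicit.AvgClosed` is `t = 1/4`); the `G`-dependent threshold ↦ `c2At
d L t = min{c₂′, t/(16(d+1)(d+4)L²)}` and, for `SU(N)`, `c2SU d L N = min{c₂′, 1/(16N(d+1)(d+4)L²)}`.  The test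
configuration of §5: `thetaN N = 2πi/N`, `ZU N = e^{θ_N·1}` (the central element `e^{2πi/N}·1 ∈ SU(N)`), `twistCfg N :
Site 2 → Fin 2 → (M_N(ℂ))ˣ`, `(x, κ) ↦ Z` if `κ = 1 ∧ x₀ = 0`, else `1`.

WHAT THIS FILE PROVES (kernel, no `sorry`, axioms `propext`, `Classical.choice`, `Quot.sound`).
* `prop2Printed_specialUnitaryGroup (N) [NeZero N] (L) (hL : 2 ≤ L) : B7.Prop2Printed (C0 d) (c2SU d L N) (fun k ↦
  concreteKStep d (Matrix (Fin N) (Fin N) ℂ) (specialUnitaryUnits (Fin N)) L k)` — PROPOSITION 2 AS PRINTED (the quoted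
  leaf of `B7.lean`) for the paper's `G = SU(N)`, `N ≥ 1`: `SU(N)`-valued configurations on `ℤ^d`, the `k`-fold average
  (43), operator norm, every `k`, `d`, `L ≥ 2`, with `C₀ = 14464(d+1)²(d+4)²` and the `N`-DEPENDENT `c₂′(d, L, SU(N)) =
  min{1/(512(d+1)(d+4)L²), 1/(16N(d+1)(d+4)L²)}`, `c₂ = min{1/(3C₀), ½c₂′}` as printed; `c2SU_eq_c2'`: for `N ≤ 32`
  this IS the `U(N)`-constant `c₂′(d, L)` of `B7Prop2Explicit`; `prop2Printed_specialUnitaryGroup'` — the same through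
  the radius `t_N = min{1/4, 1/N}`.
* `prop2_specialUnitary` — (54) together with the `SU(N)`-valuedness of every `Ū^j`, `j ≤ k`, under the explicit
  hypotheses of `B7Prop2Explicit.prop2_explicit` (`V` `SU(N)`-valued, `0 < α₀`, `C₀α₀ ≤ ⅓`, `2α₀ ≤ c₂′`, (52)) plus the
  ONE `G`-dependent smallness `N·32(d+1)(d+4)L²α₀ < π`.
* The radius-`t` machinery, for any subgroup `G` of the units of a complete normed `ℂ`-algebra with `‖1‖ = 1`:
  `AvgClosedAt` (STRUCTURE) with `AvgClosedAt.mono`, `avgClosedAt_of_avgClosed`, `AvgClosedAt.avgClosed`;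
  `avgIter_mem_at` (all `Ū^j`, `j ≤ k`, are `G`-valued under (52), `C₀α₀ ≤ ⅓`, `2α₀ ≤ c₂′`, `32(d+1)(d+4)L²α₀ ≤ t`),
  `ineq53_explicit_at` ((53) for all `j ≤ k`), `prop2_explicit_at` / `prop2_explicit_at_lt_two` ((54); at `t = 1/4`
  these are gen 14's `prop2_explicit(_lt_two)`), `prop2Printed_concrete_at` (`B7.Prop2Printed` with `c₂′(d, L, t) =
  c2At d L t` for any `G` closed at a radius `t`), `c2At_le`, `c2At_pos`, `smallness_of_le_c2At`.
* `SU(N)` IS CLOSED AT RADIUS `t ≤ 1/4`, `Nt < π` (§3): `specialUnitaryUnits` (+ `mem_specialUnitaryUnits`,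
  `specialUnitaryUnits_le_unitaryUnits`, `specialUnitaryUnits_le_U1`), `bavg_mem_specialUnitaryUnits` (`V̄_c` is
  unitary by `B7Prop2Explicit.bavg_mem_unitaryUnits`, and `det V̄_c = det e^{X_c}·det V(c) = e^{Tr X_c} = exp[Σ_x L^{−d}
  Tr log W_x] = e^0 = 1` by `ExpMeanLog.trace_mlog_eq_zero`), `avgClosedAt_specialUnitary`.
* `SU(N)` IS NOT CLOSED AT RADIUS `t ≥ 2π/N` (§5, a kernel counterexample on `ℤ²`, `L = 2`): `not_avgClosedAt_specialUnitary
  (hN : 10 ≤ N) (ht : 2π/N ≤ t) : ¬ AvgClosedAt 2 t 2 (specialUnitaryUnits (Fin N))`, `not_avgClosed_specialUnitary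
  (hN : 26 ≤ N) : ¬ AvgClosed 2 2 (specialUnitaryUnits (Fin N))` — the bonds `⟨x, x + e₁⟩`, `x₀ = 0`, carry `Z =
  e^{2πi/N}·1`, all others `1`; at `c = ⟨0, 2e₀⟩` the four `W_x`, `x ∈ B(c₋) = {0,1}²`, are `1, Z, 1, Z`
  (`Wcx_twistCfg`: the comb words (14) by `decide`, the products by `simp`), `X_c = (θ_N/2)·1` (`Xavg_twistCfg`), `V̄_c =
  e^{iπ/N}·1` (`val_bavg_twistCfg`), `det V̄_c = −1` (`det_bavg_twistCfg`), `V̄_c ∉ SU(N)` (`bavg_twistCfg_not_mem`);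
  and §5b: `pdev_twistCfg_le` (every plaquette variable is `1`, `Z` or `Z⁻¹`: `sup_p |U(∂p) − 1| ≤ 2π/N`) and
  `avg_not_specialUnitary_valued (hN : 10 ≤ N) (hα : 8π < α₀N)`: the configuration is `SU(N)`-valued, satisfies (52)
  with `k = 1`, `L = 2` for this `α₀`, and `Ū¹ ∉ SU(N)` at the origin bond — so NO `N`-independent `α₀`-threshold makes
  the average of `SU(N)`-valued (52)-configurations `SU(N)`-valued for all `N`.

METHOD = the printed proof of p. 26 exactly as certified in `B7Prop2Explicit` (whose induction `avgIter_mem` is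
repeated verbatim with the closure radius `1/4` replaced by `t`): (53) at level `j` gives `sup |Ū^j(∂p) − 1| < α₀ +
2C₀α₀² < 2α₀`, the p. 25 estimate (`norm_Wcx_sub_one_le`) puts every `log`-argument of the next average within
`16(d+1)(d+4)L²·2α₀` of `1`, and `AvgClosedAt t` needs this to be `≤ t` — the single extra hypothesis `32(d+1)(d+4)L²α₀
≤ t`, folded into `c₂′(d, L, t) = min{c₂′, t/(16(d+1)(d+4)L²)}`.  For `SU(N)`: unitarity of `V̄_c` from gen 14, `det
V̄_c = 1` from `det e^X = e^{Tr X}` and `Tr log W = 0` (`W ∈ SU(N)`, `|W − 1| ≤ 1/4`, `N|W − 1| < π`: `e^{Tr log W} = det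
W = 1` and `|Tr log W| ≤ N|log W| ≤ 2N|W − 1| < 2π`), whence the radius condition `Nt < π`; `2α₀ ≤ c2SU` gives
`N·32(d+1)(d+4)L²α₀ ≤ 1 < π`.  The counterexample is the lattice version of the central-element obstruction recorded
for the exp-mean-log of B12 (0.9) in `ExpMeanLog.eml_pair_not_mem_specialUnitaryGroup` (cell GAPS G-pv11g6-1): the
principal logarithm of `Z = e^{2πi/N}·1 ∈ SU(N)` is `(2πi/N)·1 ∉ i·su(N)` although `|Z − 1| = 2 sin(π/N) → 0`.

DIVERGENCES / WHAT IS NOT REPRODUCED (cell DIVERGENCE.md D-b07g15.1; closes clause (b) "a proper Lie subgroup `G` of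
`U(N)`, e.g. `SU(N)`, is NOT treated" of D-b07g14.1).  (a) GAUGE GROUP: `G = SU(N) ⊂ M_N(ℂ)`, `N ≥ 1`, treated; the
general "Lie subgroup `G` of `U(N)`" of p. 18 / p. 20 is covered exactly insofar as it is `AvgClosedAt t` for some
`t > 0` (`prop2Printed_concrete_at`); certified instances: `U(N)` and the unitary group of any non-trivial C⋆-algebra
(`t = 1/4`, gen 14), `SU(N)` (`t ≤ 1/4`, `Nt < π`); other closed subgroups (tori, `SO(N) ⊂ U(N)`, products) are not
instantiated.  (b) CONSTANT: the certified threshold for `SU(N)` is `c₂ = min{1/(3C₀), ½c₂′(d, L, SU(N))}` with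
`c₂′(d, L, SU(N)) = min{c₂′(d, L), 1/(16N(d+1)(d+4)L²)}` — it DEPENDS ON `N`, whereas print has `c₂′ = c₂′(d, L)`
(Prop. 1) and `c₂ = min{1/(3C₀), ½c₂′}` (Prop. 2) with no dependence on `G`; for `N ≤ 32` the certified `SU(N)`
constant equals the certified `U(N)` one.  The bound (54) itself holds for `SU(N)`-valued configurations with the
`N`-independent constants (they are `U(N)`-valued: `B7Prop2Explicit.prop2Printed_unitaryGroup`); only the
`SU(N)`-valuedness of the averages needs the `N`-dependence, and §5b proves that some `N`-dependence is NECESSARY.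
(c) Everything else as in D-b07g14.1: (52) assumed on ALL plaquettes of `ηZ^d ≅ ℤ^d` (no locality, no torus, no
subdomain `Ω`), `L ≥ 2`, `k = 0` allowed, `pdev` over all pairs `(μ, ν)`, constants admissible not optimal, `log` = the
series (21).  (d) The counterexamples of §5 live on `ℤ²` with `L = 2` (the smallest case of the setting `d ≥ 2`, `L ≥
2`; `d = 1` has no plaquettes); they are statements about the definitions (42), (52) — not about any printed claim
with `G = U(N)`.  (e) Not touched: Proposition 3 (pp. 27–36), Sects. C–F.

FINDINGS OF THE AUDIT (cell GAPS.md C-b07g15-1; located precision, not an error).  Print states Props. 1–2 in Sect. B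
for "a gauge field configuration with values in `U(N)`" (p. 23) while the paper's configurations are `G`-valued, `G`
"a Lie subgroup of a unitary group `U(N)`" (pp. 18, 20), and the averaging "transforms a configuration … into a
configuration" (p. 19; (10) integrates `δ(VŪ⁻¹)` against Haar measure of `G`).  The `G`-valuedness of (42)/(43) —
equivalently `(1/i) log U(Γ_{c,x})U(c)⁻¹ ∈ 𝔤` for the principal logarithm (22)–(23) — is automatic for `G = U(N)`
(`𝔤 =` all hermitian matrices; certified in gen 14 at radius `1/4`) but for a proper subgroup holds only near `1` AT
A `G`-DEPENDENT RADIUS: for `G = SU(N)` the principal logarithm of `W ∈ SU(N)` is guaranteed traceless only for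
`|W − 1| < 2 sin(π/N)` (eigenvalues `e^{iλ_j}`, `Σλ_j ∈ 2πℤ`, and `max|λ_j| < 2π/N` forces `Σλ_j = 0`; sharp: the central
element `e^{2πi/N}·1` has `|· − 1| = 2 sin(π/N)` and `log = (2πi/N)·1`); kernel: radius `t ≤ 1/4` with `Nt < π` suffices
(`bavg_mem_specialUnitaryUnits`), radius `t ≥ 2π/N` fails (`not_avgClosedAt_specialUnitary`, `N ≥ 10`).  Since (44)/
(52) with the printed `N`-independent `c₂′(d, L)`, `c₂` only place the `log`-arguments within `O(1)L²α₀` of `1`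
(p. 25), the clause "we can apply Proposition 1 to the configuration `Ū^j`" (p. 26) — which needs `Ū^j` to be a
`G`-valued configuration — requires, for `G = SU(N)`, `α₀ ≤ c₂(d, L, N)` with an extra factor `~1/N`
(`avg_not_specialUnitary_valued`: with any `N`-independent `α₀` and `N > 8π/α₀` an `SU(N)`-valued configuration
satisfying (52) has `Ū ∉ SU(N)`).  Repair, certified here: read "`c₂′` depends on `d` and `L`" (Prop. 1, as used in
Prop. 2 for `G`-valued configurations) as "`c₂′` depends on `d`, `L` and `G`"; for `SU(N)`: `c₂′(d, L, SU(N)) =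
min{c₂′(d, L), 1/(16N(d+1)(d+4)L²)}`.  IMMATERIAL DOWNSTREAM: the gauge group is fixed once and for all in B8–B13,
where all `O(1)` constants may depend on it, and for `N ≤ 32` the certified constants do not even change; but the
dependence exists and is not stated in print.  VALUE = Proposition 2 kernel-checked for the paper's own setting with a
PROPER Lie subgroup `G = SU(N) ⊊ U(N)` (the physically relevant gauge groups `SU(2)`, `SU(3)`), including the tacit
`G`-valuedness of all intermediate averages, with the precise `G`-dependence of the smallness threshold located and
shown necessary.  NOT summit progress by itself (ultraviolet stability needs Prop. 3 and papers B8–B13).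
-/

noncomputable section

open scoped BigOperators
open NormedSpace Finset

namespace Literature.MathematicalPhysics.QuantumFieldTheory.Balaban1983to89.B7Prop2SpecialUnitary

open B7Prop1Explicit B7Prop2Explicit MatrixLog

-- `Site` alone would resolve to the torus sites of `Setup.lean`; re-export the `ℤ^d` sites of `B7Prop1Explicit`.
export B7Prop1Explicit (Site)

variable {d : ℕ}

/-! ## §1 Closure of a gauge group under the average (42) at a threshold `t` -/

section Closure

variable {𝔸 : Type*} [NormedRing 𝔸] [NormOneClass 𝔸] [NormedAlgebra ℂ 𝔸] [CompleteSpace 𝔸]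

variable (d) in
/-- CLOSURE OF THE GAUGE GROUP UNDER THE AVERAGE AT RADIUS `t` (tacit in print: p. 20 "The group `G` is obtained by
applying the function `e^{iA}` to `A ∈ 𝔤`", so that (42) — `exp` of a real average of logarithms (22)–(23) of elements
of `G` near `1` — is `G`-valued): a subgroup `G` of `{|u| ≤ 1, |u⁻¹| ≤ 1}` such that the one-step average (42) of a
`G`-valued configuration is `G`-valued at every `L`-bond `c` all of whose `V(Γ_{c,x})V(c)⁻¹`, `x ∈ B(c₋)`, lie within
`t` of `1`.  `B7Prop2Explicit.AvgClosed` is the case `t = 1/4` (enough for the full unitary group); a proper Lie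
subgroup such as `SU(N)` is closed only at a radius shrinking with `N` (§3, §5). [cite: Balaban1985Averaging, p.20, (42)–(43) pp.23–24] -/
structure AvgClosedAt (t : ℝ) (L : ℕ) (G : Subgroup 𝔸ˣ) : Prop where
  le_U1 : G ≤ U1 𝔸
  bavg_mem : ∀ (V : Site d → Fin d → 𝔸ˣ), (∀ x κ, V x κ ∈ G) → ∀ (q : Site d) (κ : Fin d),
    (∀ r : Fin d → Fin L, ‖((Wcx L V q κ (boxVec L r) : 𝔸ˣ) : 𝔸) - 1‖ ≤ t) → bavg L V q κ ∈ G

/-- Closure at radius `t` is monotone in `t`: closed at `t` ⟹ closed at every `t′ ≤ t`. [folklore] -/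
theorem AvgClosedAt.mono {t t' : ℝ} {L : ℕ} {G : Subgroup 𝔸ˣ} (hG : AvgClosedAt d t L G) (h : t' ≤ t) :
    AvgClosedAt d t' L G :=
  ⟨hG.le_U1, fun V hV q κ hW => hG.bavg_mem V hV q κ fun r => (hW r).trans h⟩

/-- `B7Prop2Explicit.AvgClosed` (radius `1/4`) ⟹ closed at every radius `t ≤ 1/4`. [folklore] -/
theorem avgClosedAt_of_avgClosed {L : ℕ} {G : Subgroup 𝔸ˣ} (hG : AvgClosed d L G) {t : ℝ} (ht : t ≤ 1 / 4) :
    AvgClosedAt d t L G :=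
  ⟨hG.le_U1, fun V hV q κ hW => hG.bavg_mem V hV q κ fun r => (hW r).trans ht⟩

/-- Conversely, closed at a radius `t ≥ 1/4` ⟹ `AvgClosed`. [folklore] -/
theorem AvgClosedAt.avgClosed {t : ℝ} {L : ℕ} {G : Subgroup 𝔸ˣ} (hG : AvgClosedAt d t L G) (ht : 1 / 4 ≤ t) :
    AvgClosed d L G :=
  ⟨hG.le_U1, fun V hV q κ hW => hG.bavg_mem V hV q κ fun r => (hW r).trans ht⟩

end Closure

/-! ## §2 Proposition 2 for a gauge group closed at radius `t ≥ 32(d+1)(d+4)L²α₀` -/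

section Main

variable {𝔸 : Type*} [NormedRing 𝔸] [NormOneClass 𝔸] [NormedAlgebra ℂ 𝔸] [CompleteSpace 𝔸]

/-- **The `G`-valuedness of all `Ū^j`, `j ≤ k`, for a group closed at radius `t`** (tacit in print): under (52),
`C₀α₀ ≤ ⅓`, `2α₀ ≤ c₂′` AND `32(d+1)(d+4)L²α₀ ≤ t`, by induction on `j`, using (53) at level `j`
(`B7.ineq53_induction` with `k := j`) to see that `Ū^j` satisfies (44) with a constant `< 2α₀`, hence
(`B7Prop2Explicit.norm_Wcx_sub_one_le`, the p. 25 estimate "`|V₀(Γ_{c,x}) − 1| < (2d+1)LdLα₀ = O(1)L²α₀`" at level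
`j`) all `Ū^j(Γ_{c,x})Ū^j(c)⁻¹` lie within `2·8(d+1)(d+4)L²·(2α₀) = 32(d+1)(d+4)L²α₀ ≤ t` of `1`, and the closure
property `AvgClosedAt t`.  For `t = 1/4` the extra hypothesis follows from `2α₀ ≤ c₂′` and this is
`B7Prop2Explicit.avgIter_mem`. [cite: Balaban1985Averaging, (52)–(53) p.26, p.25] -/
theorem avgIter_mem_at (L : ℕ) (hL : 2 ≤ L) {G : Subgroup 𝔸ˣ} {t : ℝ} (hG : AvgClosedAt d t L G) (k : ℕ)
    (V : Site d → Fin d → 𝔸ˣ) (hV : ∀ x κ, V x κ ∈ G) {α₀ : ℝ} (hα : 0 < α₀)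
    (hα3 : C0 d * α₀ ≤ 1 / 3) (hα2 : 2 * α₀ ≤ c2' d L)
    (hαt : 32 * ((d : ℝ) + 1) * (d + 4) * (L : ℝ) ^ 2 * α₀ ≤ t)
    (h52 : pdev V < α₀ * (((L : ℝ) ^ k)⁻¹) ^ 2) :
    ∀ j ≤ k, ∀ x κ, avgIter L V j x κ ∈ G := by
  have hL1 : 1 ≤ L := le_trans (by norm_num) hL
  have hLr : (2 : ℝ) ≤ L := by exact_mod_cast hL
  have hL1r : (1 : ℝ) ≤ L := by linarith
  have hC := C0_pos d
  set η : ℝ := ((L : ℝ) ^ k)⁻¹ with hη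
  have hη0 : 0 < η := by positivity
  set a : ℕ → ℝ := fun j => pdev (avgIter L V j) with hadef
  have h52' : a 0 < α₀ * η ^ 2 := h52
  have hr0 : 0 ≤ (1 + C0 d * α₀) ^ 2 / (L : ℝ) ^ 2 := by positivity
  have hrhalf : (1 + C0 d * α₀) ^ 2 / (L : ℝ) ^ 2 ≤ 1 / 2 :=
    (B7.prop2_ratio_lt_half (C0 d) α₀ L hLr (mul_nonneg hC.le hα.le) hα3).le
  -- induction on the level, carrying the `G`-valuedness of ALL lower levels
  suffices H : ∀ j, j ≤ k → ∀ i ≤ j, ∀ x κ, avgIter L V i x κ ∈ G from fun j hj => H j hj j le_rfl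
  intro j
  induction j with
  | zero =>
      intro _ i hi
      obtain rfl : i = 0 := Nat.le_zero.mp hi
      simpa using hV
  | succ j ih =>
      intro hjk i hi
      have hjk' : j ≤ k := Nat.le_of_succ_le hjk
      have ihj := ih hjk'
      rcases Nat.lt_or_eq_of_le hi with hlt | rfl
      · exact ihj i (Nat.lt_succ_iff.mp hlt)
      -- the new level `j + 1`: first (53) at level `j`
      have hstep : ∀ i < j, ∀ P : ℝ, 0 < P → P ≤ c2' d L → a i < P →
          a (i + 1) < (L : ℝ) ^ 2 * P + C0 d * ((L : ℝ) ^ 2 * P) ^ 2 :=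
        fun i hi P hP hPc hiP => step_avgIter L hL1 hG.le_U1 V i (ihj i hi.le) P hP hPc hiP
      have hηj : (L : ℝ) ^ j * η ≤ 1 := by
        rw [hη, ← div_eq_mul_inv, div_le_one (by positivity)]
        exact pow_le_pow_right₀ hL1r hjk'
      have h53 := B7.ineq53_induction (L : ℝ) η α₀ (C0 d) (c2' d L) j a hLr hη0 hηj (C0_pos d) hα hα3 hα2
        h52' hstep j le_rfl
      have hS0 : 0 ≤ ∑ i ∈ Finset.range j, ((1 + C0 d * α₀) ^ 2 / (L : ℝ) ^ 2) ^ i :=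
        Finset.sum_nonneg fun i _ => pow_nonneg hr0 i
      have hS2 := B7.geom_bracket_le_two _ hr0 hrhalf j
      have hbound : a j < α₀ + 2 * C0 d * α₀ ^ 2 :=
        h53.trans_le (bound53_le (C0_pos d).le hα.le (by positivity) hηj hS0 hS2)
      have htwo := B7.prop2_bound_lt_two_alpha (C0 d) α₀ hα hα3
      -- so `Ū^j` satisfies (44) with `α := a j < 2α₀ ≤ c₂′`
      have hU : ∀ x κ, avgIter L V j x κ ∈ U1 𝔸 := fun x κ => hG.le_U1 (ihj j le_rfl x κ)
      have hαj0 : 0 ≤ a j := pdev_nonneg _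
      have hpos : (0 : ℝ) < 512 * ((d : ℝ) + 1) * (d + 4) * (L : ℝ) ^ 2 := by positivity
      have hsmall : 512 * (d + 1) * (d + 4) * (L : ℝ) ^ 2 * a j ≤ 1 := by
        have h1 : a j ≤ 1 / (512 * ((d : ℝ) + 1) * (d + 4) * (L : ℝ) ^ 2) := by
          have : a j ≤ c2' d L := by linarith
          exact this
        rw [le_div_iff₀ hpos] at h1
        linarith
      have h44 : ∀ (x : Site d) (κ κ' : Fin d), κ ≠ κ' →
          ‖((hol (avgIter L V j) x (plaqWord κ κ') : 𝔸ˣ) : 𝔸) - 1‖ ≤ a j :=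
        fun x κ κ' _ => le_pdev hU x κ κ'
      have haj2 : a j ≤ 2 * α₀ := (hbound.trans htwo).le
      have hK : (0 : ℝ) ≤ 16 * ((d : ℝ) + 1) * (d + 4) * (L : ℝ) ^ 2 := by positivity
      have hWcx : ∀ (q : Site d) (κ : Fin d) (r : Fin d → Fin L),
          ‖((Wcx L (avgIter L V j) q κ (boxVec L r) : 𝔸ˣ) : 𝔸) - 1‖ ≤ t := by
        intro q κ r
        refine (norm_Wcx_sub_one_le L hL1 _ hU hαj0 hsmall h44 q κ r).trans ?_
        calc 2 * (8 * ((d : ℝ) + 1) * (d + 4) * (L : ℝ) ^ 2 * a j)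
            = 16 * ((d : ℝ) + 1) * (d + 4) * (L : ℝ) ^ 2 * a j := by ring
          _ ≤ 16 * ((d : ℝ) + 1) * (d + 4) * (L : ℝ) ^ 2 * (2 * α₀) := mul_le_mul_of_nonneg_left haj2 hK
          _ = 32 * ((d : ℝ) + 1) * (d + 4) * (L : ℝ) ^ 2 * α₀ := by ring
          _ ≤ t := hαt
      intro x κ
      rw [avgIter_succ, rescale_apply]
      exact hG.bavg_mem _ (ihj j le_rfl) _ κ (hWcx _ κ)

/-- **(53) p. 26 for the concrete `k`-fold average (43) with values in a group closed at radius
`t ≥ 32(d+1)(d+4)L²α₀`:** for all `j ≤ k`, `sup_{p ⊂ Ω^{(j)}} |Ū^j(∂p) − 1| < α₀(L^jη)² + C₀(α₀(L^jη)²)²·[1 +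
L^{−2}(1+C₀α₀)² + … + (L^{−2}(1+C₀α₀)²)^{j−1}]` — `B7.ineq53_induction` with its `step` discharged by Prop. 1 at every
level (`B7Prop2Explicit.step_avgIter`, `avgIter_mem_at`). [cite: Balaban1985Averaging, (53) p.26] -/
theorem ineq53_explicit_at (L : ℕ) (hL : 2 ≤ L) {G : Subgroup 𝔸ˣ} {t : ℝ} (hG : AvgClosedAt d t L G) (k : ℕ)
    (V : Site d → Fin d → 𝔸ˣ) (hV : ∀ x κ, V x κ ∈ G) {α₀ : ℝ} (hα : 0 < α₀)
    (hα3 : C0 d * α₀ ≤ 1 / 3) (hα2 : 2 * α₀ ≤ c2' d L)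
    (hαt : 32 * ((d : ℝ) + 1) * (d + 4) * (L : ℝ) ^ 2 * α₀ ≤ t)
    (h52 : pdev V < α₀ * (((L : ℝ) ^ k)⁻¹) ^ 2) :
    ∀ j ≤ k, pdev (avgIter L V j) < α₀ * ((L : ℝ) ^ j * ((L : ℝ) ^ k)⁻¹) ^ 2 +
      C0 d * (α₀ * ((L : ℝ) ^ j * ((L : ℝ) ^ k)⁻¹) ^ 2) ^ 2 *
        ∑ i ∈ Finset.range j, ((1 + C0 d * α₀) ^ 2 / (L : ℝ) ^ 2) ^ i := by
  have hL1 : 1 ≤ L := le_trans (by norm_num) hL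
  have hLr : (2 : ℝ) ≤ L := by exact_mod_cast hL
  have hmem := avgIter_mem_at L hL hG k V hV hα hα3 hα2 hαt h52
  have hηk : (L : ℝ) ^ k * ((L : ℝ) ^ k)⁻¹ ≤ 1 := by
    rw [mul_inv_cancel₀ (by positivity)]
  exact B7.ineq53_induction (L : ℝ) _ α₀ (C0 d) (c2' d L) k (fun j => pdev (avgIter L V j)) hLr
    (by positivity) hηk (C0_pos d) hα hα3 hα2 h52
    (fun j hj P hP hPc hjP => step_avgIter L hL1 hG.le_U1 V j (hmem j hj.le) P hP hPc hjP)

/-- **Proposition 2 (54) p. 26 for the concrete `k`-fold average (43) with values in a group `G` closed under the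
average at radius `t`, kernel-checked with explicit constants, uniformly in `k`:** `V` `G`-valued, `0 < α₀`,
`C₀α₀ ≤ ⅓`, `2α₀ ≤ c₂′`, `32(d+1)(d+4)L²α₀ ≤ t`, `sup_p |U(∂p) − 1| < α₀η²` (`η = L^{−k}`) ⟹ `sup_{p ⊂ Ω^{(k)}}
|Ū^k(∂p) − 1| < α₀ + 2C₀α₀²` AND every `Ū^j`, `j ≤ k`, is `G`-valued; `C₀ = 14464(d+1)²(d+4)²`, `c₂′ =
1/(512(d+1)(d+4)L²)`.  Proof = the printed one ((53) by induction from Prop. 1, "taking `j = k`",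
`B7.prop2_of_ineq53`). [cite: Balaban1985Averaging, Prop. 2 (52)–(54) p.26] -/
theorem prop2_explicit_at (L : ℕ) (hL : 2 ≤ L) {G : Subgroup 𝔸ˣ} {t : ℝ} (hG : AvgClosedAt d t L G) (k : ℕ)
    (V : Site d → Fin d → 𝔸ˣ) (hV : ∀ x κ, V x κ ∈ G) {α₀ : ℝ} (hα : 0 < α₀)
    (hα3 : C0 d * α₀ ≤ 1 / 3) (hα2 : 2 * α₀ ≤ c2' d L)
    (hαt : 32 * ((d : ℝ) + 1) * (d + 4) * (L : ℝ) ^ 2 * α₀ ≤ t)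
    (h52 : pdev V < α₀ * (((L : ℝ) ^ k)⁻¹) ^ 2) :
    pdev (avgIter L V k) < α₀ + 2 * C0 d * α₀ ^ 2 ∧ ∀ j ≤ k, ∀ x κ, avgIter L V j x κ ∈ G := by
  have hL1 : 1 ≤ L := le_trans (by norm_num) hL
  have hLr : (2 : ℝ) ≤ L := by exact_mod_cast hL
  have hmem := avgIter_mem_at L hL hG k V hV hα hα3 hα2 hαt h52
  refine ⟨?_, hmem⟩
  have hηk : (L : ℝ) ^ k * ((L : ℝ) ^ k)⁻¹ = 1 := mul_inv_cancel₀ (by positivity)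
  exact B7.prop2_of_ineq53 (L : ℝ) _ α₀ (C0 d) (c2' d L) k (fun j => pdev (avgIter L V j)) hLr
    (by positivity) hηk (C0_pos d) hα hα3 hα2 h52
    (fun j hj P hP hPc hjP => step_avgIter L hL1 hG.le_U1 V j (hmem j hj.le) P hP hPc hjP)

/-- The last inequality of (54): the bound is `< 2α₀`.  (For `t = 1/4` the hypothesis `32(d+1)(d+4)L²α₀ ≤ t`
follows from `2α₀ ≤ c₂′ = 1/(512(d+1)(d+4)L²)`, and `prop2_explicit_at` with `avgClosedAt_of_avgClosed` is literally
`B7Prop2Explicit.prop2_explicit` — not restated.) [cite: Balaban1985Averaging, Prop. 2 (54) p.26] -/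
theorem prop2_explicit_at_lt_two (L : ℕ) (hL : 2 ≤ L) {G : Subgroup 𝔸ˣ} {t : ℝ} (hG : AvgClosedAt d t L G)
    (k : ℕ) (V : Site d → Fin d → 𝔸ˣ) (hV : ∀ x κ, V x κ ∈ G) {α₀ : ℝ} (hα : 0 < α₀)
    (hα3 : C0 d * α₀ ≤ 1 / 3) (hα2 : 2 * α₀ ≤ c2' d L)
    (hαt : 32 * ((d : ℝ) + 1) * (d + 4) * (L : ℝ) ^ 2 * α₀ ≤ t)
    (h52 : pdev V < α₀ * (((L : ℝ) ^ k)⁻¹) ^ 2) :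
    pdev (avgIter L V k) < 2 * α₀ :=
  (prop2_explicit_at L hL hG k V hV hα hα3 hα2 hαt h52).1.trans (B7.prop2_bound_lt_two_alpha (C0 d) α₀ hα hα3)

/-- The `G`-dependent threshold in the printed shape: `c₂′(d, L, t) = min{c₂′, t/(16(d+1)(d+4)L²)}`, so that
`2α₀ ≤ c₂′(d, L, t)` gives both `2α₀ ≤ c₂′` and `32(d+1)(d+4)L²α₀ ≤ t`. [cite: Balaban1985Averaging, Prop. 1 (51) p.26, Prop. 2 (54) p.26] -/
def c2At (d L : ℕ) (t : ℝ) : ℝ := min (c2' d L) (t / (16 * ((d : ℝ) + 1) * (d + 4) * (L : ℝ) ^ 2))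

/-- `c2At ≤ c2'`. [folklore] -/
theorem c2At_le (d L : ℕ) (t : ℝ) : c2At d L t ≤ c2' d L := min_le_left _ _

/-- `c2At_pos`: positive for `L ≥ 1`, `t > 0`. [folklore] -/
theorem c2At_pos (d L : ℕ) (hL : 1 ≤ L) {t : ℝ} (ht : 0 < t) : 0 < c2At d L t := by
  have : (1 : ℝ) ≤ L := by exact_mod_cast hL
  unfold c2At
  exact lt_min (c2'_pos d L hL) (by positivity)

/-- `2α₀ ≤ c2At d L t ⟹ 32(d+1)(d+4)L²α₀ ≤ t`. [folklore] -/
theorem smallness_of_le_c2At {d L : ℕ} (hL : 1 ≤ L) {t α₀ : ℝ} (h : 2 * α₀ ≤ c2At d L t) :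
    32 * ((d : ℝ) + 1) * (d + 4) * (L : ℝ) ^ 2 * α₀ ≤ t := by
  have hL1 : (1 : ℝ) ≤ L := by exact_mod_cast hL
  have hpos : (0 : ℝ) < 16 * ((d : ℝ) + 1) * (d + 4) * (L : ℝ) ^ 2 := by positivity
  have h1 : 2 * α₀ ≤ t / (16 * ((d : ℝ) + 1) * (d + 4) * (L : ℝ) ^ 2) := h.trans (min_le_right _ _)
  rw [le_div_iff₀ hpos] at h1
  linarith

end Main

/-! ## §2b The quoted leaf `B7.Prop2Printed` for a group closed at radius `t` -/

section Concrete

variable {𝔸 : Type} [NormedRing 𝔸] [NormOneClass 𝔸] [NormedAlgebra ℂ 𝔸] [CompleteSpace 𝔸]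

/-- **`B7.Prop2Printed` PROVED for the concrete `k`-fold average (43) on `ℤ^d` (`L ≥ 2`) with values in any gauge
group `G ⊂ {|u| ≤ 1, |u⁻¹| ≤ 1}` closed under the average (42) at some radius `t > 0`**, with `C₀ = 14464(d+1)²(d+4)²`
and the `G`-dependent `c₂′(d, L, t) = min{1/(512(d+1)(d+4)L²), t/(16(d+1)(d+4)L²)}`, `c₂ = min{1/(3C₀), ½c₂′}` as
printed; uniformly in `k`. [cite: Balaban1985Averaging, Prop. 2 (52)–(54) p.26] -/
theorem prop2Printed_concrete_at (L : ℕ) (hL : 2 ≤ L) {G : Subgroup 𝔸ˣ} {t : ℝ} (hG : AvgClosedAt d t L G) :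
    B7.Prop2Printed (C0 d) (c2At d L t) (fun k : ℕ => concreteKStep d 𝔸 G L k) := by
  intro k α₀ hα₀ hαmin V h52
  obtain ⟨V, hV⟩ := V
  simp only [concreteKStep] at h52 ⊢
  have hL1 : 1 ≤ L := le_trans (by norm_num) hL
  have hC := C0_pos d
  have hα3 : C0 d * α₀ ≤ 1 / 3 := by
    have h := hαmin.trans (min_le_left _ _)
    rw [le_div_iff₀ (by positivity : (0 : ℝ) < 3 * C0 d)] at h
    linarith
  have hα2t : 2 * α₀ ≤ c2At d L t := by
    have h := hαmin.trans (min_le_right _ _)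
    linarith
  have hα2 : 2 * α₀ ≤ c2' d L := hα2t.trans (c2At_le d L t)
  have hαt := smallness_of_le_c2At hL1 hα2t
  have hLk : (0 : ℝ) < ((L : ℝ) ^ k) ^ 2 := by positivity
  have h52' : pdev V < α₀ * (((L : ℝ) ^ k)⁻¹) ^ 2 := by
    rw [inv_pow, ← div_eq_mul_inv, lt_div_iff₀ hLk]
    exact h52
  exact (prop2_explicit_at L hL hG k V hV hα₀ hα3 hα2 hαt h52').1

end Concrete

/-! ## §3 `G = SU(N)`: the average (42) is `SU(N)`-valued at radius `t ≤ 1/4` with `Nt < π`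
(`det e^X = e^{Tr X}` and `Tr log W = 0`) -/

section SpecialUnitaryGroup

variable {n : Type*} [Fintype n] [DecidableEq n]

/-- The paper's "Lie subgroup `G` of a unitary group `U(N)`" (p. 18, p. 20) in the case `G = SU(N)`: the units of
`M_N(ℂ)` whose value lies in Mathlib's `Matrix.specialUnitaryGroup` (`u⋆u = uu⋆ = 1`, `det u = 1`).
[cite: Balaban1985Averaging, p.18, p.20] -/
def specialUnitaryUnits (n : Type*) [Fintype n] [DecidableEq n] : Subgroup (Matrix n n ℂ)ˣ where
  carrier := {u | (u : Matrix n n ℂ) ∈ Matrix.specialUnitaryGroup n ℂ}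
  mul_mem' := by
    intro u v hu hv
    simp only [Set.mem_setOf_eq, Units.val_mul] at *
    exact Submonoid.mul_mem _ hu hv
  one_mem' := by
    simp only [Set.mem_setOf_eq, Units.val_one]
    exact Submonoid.one_mem _
  inv_mem' := by
    intro u hu
    simp only [Set.mem_setOf_eq] at *
    rw [Matrix.mem_specialUnitaryGroup_iff] at hu ⊢
    have hU : u ∈ unitaryUnits (Matrix n n ℂ) := hu.1
    refine ⟨(unitaryUnits (Matrix n n ℂ)).inv_mem hU, ?_⟩
    have h := congrArg Matrix.det u.mul_inv
    rw [Matrix.det_mul, hu.2, one_mul, Matrix.det_one] at h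
    exact h

/-- `mem_specialUnitaryUnits`: membership unfolds to `u ∈ SU(N)`. [folklore] -/
@[simp] theorem mem_specialUnitaryUnits {u : (Matrix n n ℂ)ˣ} :
    u ∈ specialUnitaryUnits n ↔ (u : Matrix n n ℂ) ∈ Matrix.specialUnitaryGroup n ℂ := Iff.rfl

/-- `SU(N) ⊂ U(N)`. [folklore] -/
theorem specialUnitaryUnits_le_unitaryUnits : specialUnitaryUnits n ≤ unitaryUnits (Matrix n n ℂ) :=
  fun _ hu => (Matrix.mem_specialUnitaryGroup_iff.1 hu).1

open scoped Matrix.Norms.L2Operator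

/-- **The average (42) of an `SU(N)`-valued configuration is `SU(N)`-valued at radius `t ≤ 1/4`, `Nt < π`** (the
tacit `G`-valuedness of (42)/(43), p. 20 "The group `G` is obtained by applying the function `e^{iA}` to `A ∈ 𝔤`",
for `G = SU(N)`, `𝔤 = ` traceless hermitian matrices): if every `W_x = V(Γ_{c,x})V(c)⁻¹ ∈ SU(N)`, `x ∈ B(c₋)`, has
`|W_x − 1| ≤ t`, then `V̄_c` is unitary (`B7Prop2Explicit.bavg_mem_unitaryUnits`, (22)–(23)) and `det V̄_c =
det e^{X_c} · det V(c) = e^{Tr X_c} = exp[Σ_x L^{−d} Tr log W_x] = e^0 = 1`, because `Tr log W = 0` for `W ∈ SU(N)`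
with `|W − 1| ≤ 1/3`, `N|W − 1| < π` (`ExpMeanLog.trace_mlog_eq_zero`: `e^{Tr log W} = det W = 1` and `|Tr log W| ≤
N|log W| ≤ 2N|W − 1| < 2π`, (20), (26)).  The hypothesis `Nt < π` cannot be dropped (§5). [cite: Balaban1985Averaging, (42) p.23, p.20, (20)–(23) p.21] -/
theorem bavg_mem_specialUnitaryUnits {V : Site d → Fin d → (Matrix n n ℂ)ˣ}
    (hV : ∀ x κ, V x κ ∈ specialUnitaryUnits n) (L : ℕ) (q : Site d) (κ : Fin d) {t : ℝ} (ht4 : t ≤ 1 / 4)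
    (htπ : Fintype.card n * t < Real.pi)
    (hW : ∀ r : Fin d → Fin L, ‖((Wcx L V q κ (boxVec L r) : (Matrix n n ℂ)ˣ) : Matrix n n ℂ) - 1‖ ≤ t) :
    bavg L V q κ ∈ specialUnitaryUnits n := by
  letI : CStarAlgebra (Matrix n n ℂ) := {}
  have hVU : ∀ x κ, V x κ ∈ unitaryUnits (Matrix n n ℂ) := fun x κ =>
    specialUnitaryUnits_le_unitaryUnits (hV x κ)
  have hU : bavg L V q κ ∈ unitaryUnits (Matrix n n ℂ) :=
    bavg_mem_unitaryUnits hVU L q κ fun r => (hW r).trans ht4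
  have hWm : ∀ r : Fin d → Fin L, Wcx L V q κ (boxVec L r) ∈ specialUnitaryUnits n := fun r =>
    (specialUnitaryUnits n).mul_mem (hol_mem_of hV _ _) ((specialUnitaryUnits n).inv_mem (hol_mem_of hV _ _))
  have htr : ∀ r : Fin d → Fin L,
      (mlog ((Wcx L V q κ (boxVec L r) : (Matrix n n ℂ)ˣ) : Matrix n n ℂ)).trace = 0 := fun r =>
    ExpMeanLog.trace_mlog_eq_zero (hWm r) ((hW r).trans (ht4.trans (by norm_num)))
      ((mul_le_mul_of_nonneg_left (hW r) (Nat.cast_nonneg _)).trans_lt htπ)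
  have hX : (Xavg L V q κ).trace = 0 := by
    unfold Xavg
    rw [Matrix.trace_sum]
    exact Finset.sum_eq_zero fun r _ => by rw [Matrix.trace_smul, htr r, smul_zero]
  have hdet : ((hol V q (seg κ L) : (Matrix n n ℂ)ˣ) : Matrix n n ℂ).det = 1 :=
    (Matrix.mem_specialUnitaryGroup_iff.1 (hol_mem_of hV q (seg κ L))).2
  rw [mem_specialUnitaryUnits, Matrix.mem_specialUnitaryGroup_iff]
  refine ⟨hU, ?_⟩
  show ((expUnit (Xavg L V q κ) * hol V q (seg κ L) : (Matrix n n ℂ)ˣ) : Matrix n n ℂ).det = 1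
  rw [Units.val_mul, Matrix.det_mul, hdet, mul_one, val_expUnit,
    Literature.Analysis.Matrix.det_exp_eq_exp_trace, hX, exp_zero]

variable [Nonempty n]

/-- `SU(N) ⊂ {|u| ≤ 1, |u⁻¹| ≤ 1}` for the operator norm (19). [cite: Balaban1985Averaging, (19) p.21] -/
theorem specialUnitaryUnits_le_U1 : specialUnitaryUnits n ≤ U1 (Matrix n n ℂ) := by
  letI : CStarAlgebra (Matrix n n ℂ) := {}
  exact le_trans specialUnitaryUnits_le_unitaryUnits unitaryUnits_le_U1

variable (d) in
/-- **`SU(N)` is an admissible gauge group for Prop. 2 at every radius `t ≤ 1/4` with `Nt < π`** (`AvgClosedAt`).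
[cite: Balaban1985Averaging, (42)–(43) pp.23–24, p.20] -/
theorem avgClosedAt_specialUnitary (L : ℕ) {t : ℝ} (ht4 : t ≤ 1 / 4) (htπ : Fintype.card n * t < Real.pi) :
    AvgClosedAt d t L (specialUnitaryUnits n) :=
  ⟨specialUnitaryUnits_le_U1, fun _ hV q κ hW => bavg_mem_specialUnitaryUnits hV _ q κ ht4 htπ hW⟩

/-- **Proposition 2 (54) for `SU(N)`-valued configurations, explicit:** the hypotheses of
`B7Prop2Explicit.prop2_explicit` (`0 < α₀`, `C₀α₀ ≤ ⅓`, `2α₀ ≤ c₂′`, (52)) plus ONE `G`-dependent smallness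
`N · 32(d+1)(d+4)L²α₀ < π` ⟹ (54) `sup_{p ⊂ Ω^{(k)}} |Ū^k(∂p) − 1| < α₀ + 2C₀α₀²` and every `Ū^j`, `j ≤ k`, is
`SU(N)`-valued. [cite: Balaban1985Averaging, Prop. 2 (52)–(54) p.26] -/
theorem prop2_specialUnitary (L : ℕ) (hL : 2 ≤ L) (k : ℕ) (V : Site d → Fin d → (Matrix n n ℂ)ˣ)
    (hV : ∀ x κ, V x κ ∈ specialUnitaryUnits n) {α₀ : ℝ} (hα : 0 < α₀) (hα3 : C0 d * α₀ ≤ 1 / 3)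
    (hα2 : 2 * α₀ ≤ c2' d L)
    (hαN : Fintype.card n * (32 * ((d : ℝ) + 1) * (d + 4) * (L : ℝ) ^ 2 * α₀) < Real.pi)
    (h52 : pdev V < α₀ * (((L : ℝ) ^ k)⁻¹) ^ 2) :
    pdev (avgIter L V k) < α₀ + 2 * C0 d * α₀ ^ 2 ∧
      ∀ j ≤ k, ∀ x κ, avgIter L V j x κ ∈ specialUnitaryUnits n := by
  have hL1 : (1 : ℝ) ≤ L := by exact_mod_cast le_trans (by norm_num) hL
  have hpos : (0 : ℝ) < 512 * ((d : ℝ) + 1) * (d + 4) * (L : ℝ) ^ 2 := by positivity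
  have ht4 : 32 * ((d : ℝ) + 1) * (d + 4) * (L : ℝ) ^ 2 * α₀ ≤ 1 / 4 := by
    have h1 : 2 * α₀ ≤ 1 / (512 * ((d : ℝ) + 1) * (d + 4) * (L : ℝ) ^ 2) := hα2
    rw [le_div_iff₀ hpos] at h1
    linarith
  exact prop2_explicit_at L hL (avgClosedAt_specialUnitary d L ht4 hαN) k V hV hα hα3 hα2 le_rfl h52

end SpecialUnitaryGroup

/-! ## §4 The paper's setting `G = SU(N) ⊂ M_N(ℂ)`, operator norm (19): `B7.Prop2Printed` with
`c₂′(d, L, SU(N)) = min{c₂′, 1/(16N(d+1)(d+4)L²)}` -/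

section Matrices

open scoped Matrix.Norms.L2Operator

/-- The `SU(N)`-threshold of Prop. 2: `c₂′(d, L, SU(N)) = min{1/(512(d+1)(d+4)L²), 1/(16N(d+1)(d+4)L²)}` — equal to
the `U(N)` constant `c₂′ = 1/(512(d+1)(d+4)L²)` for `N ≤ 32` (`c2SU_eq_c2'`), and `= 1/(16N(d+1)(d+4)L²)` beyond.
[cite: Balaban1985Averaging, Prop. 1 (51) p.26, Prop. 2 (54) p.26] -/
def c2SU (d L N : ℕ) : ℝ := min (c2' d L) (1 / (16 * (N : ℝ) * ((d : ℝ) + 1) * (d + 4) * (L : ℝ) ^ 2))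

/-- For `N ≤ 32` the `SU(N)`-threshold IS the printed/certified `c₂′(d, L)` of `U(N)`. [folklore] -/
theorem c2SU_eq_c2' {d L N : ℕ} (hL : 1 ≤ L) (hN1 : 1 ≤ N) (hN : N ≤ 32) : c2SU d L N = c2' d L := by
  have hLr : (1 : ℝ) ≤ L := by exact_mod_cast hL
  have hNr : (N : ℝ) ≤ 32 := by exact_mod_cast hN
  have hN1r : (1 : ℝ) ≤ N := by exact_mod_cast hN1
  unfold c2SU c2'
  refine min_eq_left ?_
  have hA : (0 : ℝ) < 16 * (N : ℝ) * ((d : ℝ) + 1) * (d + 4) * (L : ℝ) ^ 2 := by positivity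
  have hB : (0 : ℝ) < 512 * ((d : ℝ) + 1) * (d + 4) * (L : ℝ) ^ 2 := by positivity
  rw [div_le_div_iff₀ hB hA, one_mul, one_mul]
  have h0 : (0 : ℝ) ≤ ((d : ℝ) + 1) * (d + 4) * (L : ℝ) ^ 2 := by positivity
  nlinarith

/-- **Proposition 2 of B7 for `G = SU(N)`, `N ≥ 1`, verbatim setting** (`B7.Prop2Printed`): configurations on `ℤ^d`
with values in `SU(N) ⊂ M_N(ℂ)`, `|·|` the operator norm (19), the `k`-fold average (43), `L ≥ 2`, uniformly in
`k`, with `C₀ = 14464(d+1)²(d+4)²` and `c₂′ = c₂′(d, L, SU(N)) = min{1/(512(d+1)(d+4)L²), 1/(16N(d+1)(d+4)L²)}`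
(`= 1/(512(d+1)(d+4)L²)` for `N ≤ 32`), `c₂ = min{1/(3C₀), ½c₂′}`. [cite: Balaban1985Averaging, Prop. 2 (52)–(54) p.26] -/
theorem prop2Printed_specialUnitaryGroup (N : ℕ) [NeZero N] (L : ℕ) (hL : 2 ≤ L) :
    B7.Prop2Printed (C0 d) (c2SU d L N)
      (fun k : ℕ => concreteKStep d (Matrix (Fin N) (Fin N) ℂ) (specialUnitaryUnits (Fin N)) L k) := by
  intro k α₀ hα₀ hαmin V h52
  obtain ⟨V, hV⟩ := V
  simp only [concreteKStep] at h52 ⊢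
  have hL1r : (1 : ℝ) ≤ L := by exact_mod_cast le_trans (by norm_num) hL
  have hNr : (1 : ℝ) ≤ N := by exact_mod_cast Nat.one_le_iff_ne_zero.mpr (NeZero.ne N)
  have hC := C0_pos d
  have hα3 : C0 d * α₀ ≤ 1 / 3 := by
    have h := hαmin.trans (min_le_left _ _)
    rw [le_div_iff₀ (by positivity : (0 : ℝ) < 3 * C0 d)] at h
    linarith
  have hα2S : 2 * α₀ ≤ c2SU d L N := by
    have h := hαmin.trans (min_le_right _ _)
    linarith
  have hα2 : 2 * α₀ ≤ c2' d L := hα2S.trans (min_le_left _ _)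
  have hαN : Fintype.card (Fin N) * (32 * ((d : ℝ) + 1) * (d + 4) * (L : ℝ) ^ 2 * α₀) < Real.pi := by
    rw [Fintype.card_fin]
    have hA : (0 : ℝ) < 16 * (N : ℝ) * ((d : ℝ) + 1) * (d + 4) * (L : ℝ) ^ 2 := by positivity
    have h1 : 2 * α₀ ≤ 1 / (16 * (N : ℝ) * ((d : ℝ) + 1) * (d + 4) * (L : ℝ) ^ 2) :=
      hα2S.trans (min_le_right _ _)
    rw [le_div_iff₀ hA] at h1
    have hπ : (1 : ℝ) < Real.pi := by have := Real.pi_gt_three; linarith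
    calc (N : ℝ) * (32 * ((d : ℝ) + 1) * (d + 4) * (L : ℝ) ^ 2 * α₀)
        = 2 * α₀ * (16 * (N : ℝ) * ((d : ℝ) + 1) * (d + 4) * (L : ℝ) ^ 2) := by ring
      _ ≤ 1 := h1
      _ < Real.pi := hπ
  have hLk : (0 : ℝ) < ((L : ℝ) ^ k) ^ 2 := by positivity
  have h52' : pdev V < α₀ * (((L : ℝ) ^ k)⁻¹) ^ 2 := by
    rw [inv_pow, ← div_eq_mul_inv, lt_div_iff₀ hLk]
    exact h52
  exact (prop2_specialUnitary L hL k V hV hα₀ hα3 hα2 hαN h52').1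

/-- The same through the generic radius-`t` leaf: `SU(N)` is closed at radius `t_N = min{1/4, 1/N}`, so
`prop2Printed_concrete_at` applies with `c₂′(d, L, t_N)`. [cite: Balaban1985Averaging, Prop. 2 (52)–(54) p.26] -/
theorem prop2Printed_specialUnitaryGroup' (N : ℕ) [NeZero N] (L : ℕ) (hL : 2 ≤ L) :
    B7.Prop2Printed (C0 d) (c2At d L (min (1 / 4) (1 / (N : ℝ))))
      (fun k : ℕ => concreteKStep d (Matrix (Fin N) (Fin N) ℂ) (specialUnitaryUnits (Fin N)) L k) := by
  have hNr : (0 : ℝ) < N := by exact_mod_cast Nat.pos_of_ne_zero (NeZero.ne N)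
  refine prop2Printed_concrete_at L hL (avgClosedAt_specialUnitary d L (min_le_left _ _) ?_)
  rw [Fintype.card_fin]
  have hπ : (1 : ℝ) < Real.pi := by have := Real.pi_gt_three; linarith
  calc (N : ℝ) * min (1 / 4) (1 / (N : ℝ)) ≤ (N : ℝ) * (1 / (N : ℝ)) :=
        mul_le_mul_of_nonneg_left (min_le_right _ _) hNr.le
    _ = 1 := by field_simp
    _ < Real.pi := hπ

end Matrices

/-! ## §5 The `SU(N)` radius must shrink like `1/N`: `SU(N)` is NOT closed under the average (42) at radius `t`
as soon as `Nt ≥ 2π` — in particular not at the `U(N)` radius `1/4` for `N ≥ 26` (a kernel counterexample on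
`ℤ²`, `L = 2`) -/

section Negative

open scoped Matrix.Norms.L2Operator

/-- `θ_N = 2πi/N`. [folklore] -/
def thetaN (N : ℕ) : ℂ := ((2 * Real.pi / N : ℝ) : ℂ) * Complex.I

/-- The central element `Z = e^{θ_N·1} = e^{2πi/N}·1` of `SU(N)`, as a unit of `M_N(ℂ)`. [folklore] -/
def ZU (N : ℕ) : (Matrix (Fin N) (Fin N) ℂ)ˣ := expUnit (thetaN N • (1 : Matrix (Fin N) (Fin N) ℂ))

/-- The test configuration on `ℤ²`: the bonds `⟨x, x + e₁⟩` issuing from the line `x₀ = 0` carry `Z`, all other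
bonds carry `1` (an `SU(N)`-valued lattice configuration all of whose plaquette variables are `Z^{±1}` or `1`).
[folklore] -/
def twistCfg (N : ℕ) : Site 2 → Fin 2 → (Matrix (Fin N) (Fin N) ℂ)ˣ :=
  fun x κ => if κ = 1 ∧ x 0 = 0 then ZU N else 1

/-- `val_ZU`: `Z = e^{θ_N}·1`. [folklore] -/
theorem val_ZU (N : ℕ) : (ZU N : Matrix (Fin N) (Fin N) ℂ) = Complex.exp (thetaN N) • 1 := by
  rw [ZU, val_expUnit, ExpMeanLog.exp_smul_one_eq]

/-- `Nθ_N = 2πi`. [folklore] -/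
theorem natCast_mul_thetaN (N : ℕ) [NeZero N] : (N : ℂ) * thetaN N = 2 * Real.pi * Complex.I := by
  have hN0 : (N : ℂ) ≠ 0 := Nat.cast_ne_zero.mpr (NeZero.ne N)
  rw [thetaN, Complex.ofReal_div, Complex.ofReal_mul, Complex.ofReal_natCast, Complex.ofReal_ofNat]
  field_simp

/-- `N(θ_N/2) = πi`. [folklore] -/
theorem natCast_mul_thetaN_half (N : ℕ) [NeZero N] : (N : ℂ) * (thetaN N / 2) = Real.pi * Complex.I := by
  rw [mul_div_assoc', natCast_mul_thetaN]; ring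

/-- `|θ_N| = 2π/N`. [folklore] -/
theorem norm_thetaN (N : ℕ) : ‖thetaN N‖ = 2 * Real.pi / N := by
  rw [thetaN, norm_mul, Complex.norm_I, mul_one, Complex.norm_real, Real.norm_of_nonneg (by positivity)]

/-- `Z ∈ SU(N)`: `ZZ⋆ = |e^{θ_N}|²·1 = 1` and `det Z = e^{Nθ_N} = e^{2πi} = 1`. [folklore] -/
theorem ZU_mem (N : ℕ) [NeZero N] : ZU N ∈ specialUnitaryUnits (Fin N) := by
  rw [mem_specialUnitaryUnits, val_ZU, Matrix.mem_specialUnitaryGroup_iff]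
  refine ⟨?_, ?_⟩
  · rw [Matrix.mem_unitaryGroup_iff, star_smul, star_one, smul_mul_assoc, one_mul, smul_smul,
      Complex.star_def, Complex.mul_conj, Complex.normSq_eq_norm_sq, thetaN, Complex.norm_exp_ofReal_mul_I]
    simp
  · rw [Matrix.det_smul, Matrix.det_one, mul_one, Fintype.card_fin, ← Complex.exp_nat_mul, natCast_mul_thetaN,
      Complex.exp_two_pi_mul_I]

/-- `|Z − 1| = |e^{2πi/N} − 1| ≤ 2π/N` (operator norm (19)). [folklore] -/
theorem norm_ZU_sub_one (N : ℕ) [NeZero N] : ‖(ZU N : Matrix (Fin N) (Fin N) ℂ) - 1‖ ≤ 2 * Real.pi / N := by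
  have h1 : (ZU N : Matrix (Fin N) (Fin N) ℂ) - 1 =
      (Complex.exp (thetaN N) - 1) • (1 : Matrix (Fin N) (Fin N) ℂ) := by
    rw [sub_smul, one_smul, val_ZU]
  rw [h1, norm_smul, CStarRing.norm_one, mul_one]
  have h2 : ‖Complex.exp (thetaN N) - 1‖ ≤ ‖(2 * Real.pi / N : ℝ)‖ := by
    rw [thetaN, mul_comm]; exact Real.norm_exp_I_mul_ofReal_sub_one_le
  rwa [Real.norm_of_nonneg (by positivity)] at h2

/-- `log Z = θ_N·1` for `N ≥ 10` (`|θ_N·1| = 2π/N < ln 2`, so the series (21) inverts `exp` there,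
`B7BlockAvgLog.mlog_exp`; this is the principal logarithm (22)–(23) of `Z`). [cite: Balaban1985Averaging, (20)–(23) pp.20–21] -/
theorem mlog_ZU {N : ℕ} (hN : 10 ≤ N) : mlog (ZU N : Matrix (Fin N) (Fin N) ℂ) = thetaN N • 1 := by
  haveI : NeZero N := ⟨by omega⟩
  rw [ZU, val_expUnit]
  refine B7BlockAvgLog.mlog_exp ?_
  rw [norm_smul, CStarRing.norm_one, mul_one, norm_thetaN]
  have hπ := Real.pi_lt_d2
  have hl := Real.log_two_gt_d9
  have hN' : (10 : ℝ) ≤ N := by exact_mod_cast hN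
  rw [div_lt_iff₀ (by positivity)]
  nlinarith

/-- The test configuration is `SU(N)`-valued. [folklore] -/
theorem twistCfg_mem (N : ℕ) [NeZero N] :
    ∀ (x : Site 2) (κ : Fin 2), twistCfg N x κ ∈ specialUnitaryUnits (Fin N) := by
  intro x κ
  unfold twistCfg
  split_ifs
  exacts [ZU_mem N, (specialUnitaryUnits (Fin N)).one_mem]

/-- The straight contour `Γ_c` of `c = ⟨0, 2e₀⟩` carries `V(c) = 1`. [folklore] -/
theorem hol_seg_twistCfg (N : ℕ) : hol (twistCfg N) 0 (seg (0 : Fin 2) ((2 : ℕ) : ℤ)) = 1 := by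
  have hs : seg (0 : Fin 2) ((2 : ℕ) : ℤ) = [(0, true), (0, true)] := by decide
  rw [hs]
  simp [stepHol_true, twistCfg]

/-- **The four `log`-arguments of (42) at the bond `c = ⟨0, 2e₀⟩`:** `V(Γ_{c,x})V(c)⁻¹ = Z` for the two points
`x = (x₀, 1)` of `B(c₋) = {0,1}²` (the comb path (14) leaves `c₋ = 0` along the twisted bond `⟨0, e₁⟩` and returns
along the untwisted `⟨2e₀ + e₁, 2e₀⟩`), and `= 1` for the two points `x = (x₀, 0)`. [cite: Balaban1985Averaging, (14) p.19, (42) p.23] -/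
theorem Wcx_twistCfg (N : ℕ) (r : Fin 2 → Fin 2) :
    Wcx 2 (twistCfg N) 0 0 (boxVec 2 r) = if r 1 = 1 then ZU N else 1 := by
  have hs : seg (0 : Fin 2) ((2 : ℕ) : ℤ) = [(0, true), (0, true)] := by decide
  have key : ∀ a b : Fin 2, Wcx 2 (twistCfg N) 0 0 (boxVec 2 ![a, b]) = if b = 1 then ZU N else 1 := by
    intro a b
    fin_cases a <;> fin_cases b
    · have hw : gammaWord 2 (0 : Fin 2) (boxVec 2 ![(0 : Fin 2), 0]) = [(0, true), (0, true)] := by decide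
      show hol (twistCfg N) 0 (gammaWord 2 (0 : Fin 2) (boxVec 2 ![(0 : Fin 2), 0])) *
          (hol (twistCfg N) 0 (seg (0 : Fin 2) ((2 : ℕ) : ℤ)))⁻¹ = if (0 : Fin 2) = 1 then ZU N else 1
      rw [hw, hs]
      simp [stepHol_true, twistCfg, e_apply]
    · have hw : gammaWord 2 (0 : Fin 2) (boxVec 2 ![(0 : Fin 2), 1]) =
          [(1, true), (0, true), (0, true), (1, false)] := by decide
      show hol (twistCfg N) 0 (gammaWord 2 (0 : Fin 2) (boxVec 2 ![(0 : Fin 2), 1])) *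
          (hol (twistCfg N) 0 (seg (0 : Fin 2) ((2 : ℕ) : ℤ)))⁻¹ = if (1 : Fin 2) = 1 then ZU N else 1
      rw [hw, hs]
      simp [stepHol_true, stepHol_false, twistCfg, e_apply]
    · have hw : gammaWord 2 (0 : Fin 2) (boxVec 2 ![(1 : Fin 2), 0]) =
          [(0, true), (0, true), (0, true), (0, false)] := by decide
      show hol (twistCfg N) 0 (gammaWord 2 (0 : Fin 2) (boxVec 2 ![(1 : Fin 2), 0])) *
          (hol (twistCfg N) 0 (seg (0 : Fin 2) ((2 : ℕ) : ℤ)))⁻¹ = if (0 : Fin 2) = 1 then ZU N else 1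
      rw [hw, hs]
      simp [stepHol_true, stepHol_false, twistCfg, e_apply]
    · have hw : gammaWord 2 (0 : Fin 2) (boxVec 2 ![(1 : Fin 2), 1]) =
          [(1, true), (0, true), (0, true), (0, true), (0, false), (1, false)] := by decide
      show hol (twistCfg N) 0 (gammaWord 2 (0 : Fin 2) (boxVec 2 ![(1 : Fin 2), 1])) *
          (hol (twistCfg N) 0 (seg (0 : Fin 2) ((2 : ℕ) : ℤ)))⁻¹ = if (1 : Fin 2) = 1 then ZU N else 1
      rw [hw, hs]
      simp [stepHol_true, stepHol_false, twistCfg, e_apply]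
  have hr : r = ![r 0, r 1] := by
    ext i; fin_cases i <;> rfl
  rw [hr]
  simpa using key (r 0) (r 1)

/-- A sum over the four points of `B(c₋) = {0,1}²` of a function of the second coordinate. [folklore] -/
theorem sum_pi_fin_two {M : Type*} [AddCommMonoid M] (F : Fin 2 → M) :
    ∑ r : Fin 2 → Fin 2, F (r 1) = F 0 + F 1 + (F 0 + F 1) := by
  rw [Fintype.sum_equiv (piFinTwoEquiv fun _ => Fin 2) (fun r : Fin 2 → Fin 2 => F (r 1)) (fun p => F p.2)
    (fun r => rfl), Fintype.sum_prod_type]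
  simp only [Fin.sum_univ_two]

/-- **The exponent of (42) at `c = ⟨0, 2e₀⟩`:** `X_c = Σ_x 2^{−2} log[V(Γ_{c,x})V(c)⁻¹] = ¼(0 + θ_N·1 + 0 + θ_N·1)
= (θ_N/2)·1` (`N ≥ 10`). [cite: Balaban1985Averaging, (42) p.23] -/
theorem Xavg_twistCfg {N : ℕ} (hN : 10 ≤ N) :
    Xavg 2 (twistCfg N) 0 0 = (thetaN N / 2) • (1 : Matrix (Fin N) (Fin N) ℂ) := by
  have h1 : ∀ r : Fin 2 → Fin 2,
      mlog ((Wcx 2 (twistCfg N) 0 0 (boxVec 2 r) : (Matrix (Fin N) (Fin N) ℂ)ˣ) : Matrix (Fin N) (Fin N) ℂ)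
        = if r 1 = 1 then thetaN N • (1 : Matrix (Fin N) (Fin N) ℂ) else 0 := by
    intro r
    rw [Wcx_twistCfg]
    split_ifs
    · exact mlog_ZU hN
    · rw [Units.val_one, mlog_one]
  unfold Xavg
  simp_rw [h1]
  rw [sum_pi_fin_two (fun b : Fin 2 =>
    (((2 : ℕ) : ℝ) ^ 2)⁻¹ • (if b = 1 then thetaN N • (1 : Matrix (Fin N) (Fin N) ℂ) else 0))]
  have h01 : ¬ ((0 : Fin 2) = 1) := by decide
  simp only [if_neg h01, if_true, smul_zero, zero_add]
  rw [RCLike.real_smul_eq_coe_smul (K := ℂ), smul_smul, ← add_smul]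
  congr 1
  push_cast
  ring

/-- **The average (42) of the test configuration at `c = ⟨0, 2e₀⟩`:** `V̄_c = exp[(θ_N/2)·1]·V(c) = e^{iπ/N}·1`
(`N ≥ 10`). [cite: Balaban1985Averaging, (42) p.23] -/
theorem val_bavg_twistCfg {N : ℕ} (hN : 10 ≤ N) :
    ((bavg 2 (twistCfg N) 0 0 : (Matrix (Fin N) (Fin N) ℂ)ˣ) : Matrix (Fin N) (Fin N) ℂ) =
      Complex.exp (thetaN N / 2) • (1 : Matrix (Fin N) (Fin N) ℂ) := by
  show ((expUnit (Xavg 2 (twistCfg N) 0 0) * hol (twistCfg N) 0 (seg (0 : Fin 2) ((2 : ℕ) : ℤ)) :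
    (Matrix (Fin N) (Fin N) ℂ)ˣ) : Matrix (Fin N) (Fin N) ℂ) = _
  rw [hol_seg_twistCfg, mul_one, val_expUnit, Xavg_twistCfg hN, ExpMeanLog.exp_smul_one_eq]

/-- **`det V̄_c = (e^{iπ/N})^N = e^{iπ} = −1`** at `c = ⟨0, 2e₀⟩` (`N ≥ 10`). [folklore] -/
theorem det_bavg_twistCfg {N : ℕ} (hN : 10 ≤ N) :
    ((bavg 2 (twistCfg N) 0 0 : (Matrix (Fin N) (Fin N) ℂ)ˣ) : Matrix (Fin N) (Fin N) ℂ).det = -1 := by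
  haveI : NeZero N := ⟨by omega⟩
  rw [val_bavg_twistCfg hN, Matrix.det_smul, Matrix.det_one, mul_one, Fintype.card_fin, ← Complex.exp_nat_mul,
    natCast_mul_thetaN_half, Complex.exp_pi_mul_I]

/-- **`V̄_c ∉ SU(N)`** at `c = ⟨0, 2e₀⟩` for the `SU(N)`-valued test configuration (`N ≥ 10`). [folklore] -/
theorem bavg_twistCfg_not_mem {N : ℕ} (hN : 10 ≤ N) : bavg 2 (twistCfg N) 0 0 ∉ specialUnitaryUnits (Fin N) := by
  intro hmem
  have hdet := (Matrix.mem_specialUnitaryGroup_iff.1 (mem_specialUnitaryUnits.1 hmem)).2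
  rw [det_bavg_twistCfg hN] at hdet
  norm_num at hdet

/-- **`SU(N)` is NOT closed under the average (42) at any radius `t ≥ 2π/N`** (`N ≥ 10`; on `ℤ²` with `L = 2`): the
`SU(N)`-valued configuration `twistCfg` has all four `V(Γ_{c,x})V(c)⁻¹ ∈ {Z, 1}` within `2π/N ≤ t` of `1` at
`c = ⟨0, 2e₀⟩`, yet `V̄_c = exp[(θ_N/2)·1]·1 = e^{iπ/N}·1` has `det V̄_c = e^{iπ} = −1`: `V̄_c ∉ SU(N)`.  So the
radius of `G`-valuedness of (42) for `G = SU(N)` is `< 2π/N` (§3 certifies every radius `t ≤ 1/4` with `Nt < π`);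
cf. `ExpMeanLog.eml_pair_not_mem_specialUnitaryGroup` for the two-member exp-mean-log of B12 (0.9).
[cite: Balaban1985Averaging, (42) p.23, p.20] -/
theorem not_avgClosedAt_specialUnitary {N : ℕ} [NeZero N] (hN : 10 ≤ N) {t : ℝ} (ht : 2 * Real.pi / N ≤ t) :
    ¬ AvgClosedAt 2 t 2 (specialUnitaryUnits (Fin N)) := by
  intro hG
  have hW : ∀ r : Fin 2 → Fin 2,
      ‖((Wcx 2 (twistCfg N) 0 0 (boxVec 2 r) : (Matrix (Fin N) (Fin N) ℂ)ˣ) : Matrix (Fin N) (Fin N) ℂ) - 1‖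
        ≤ t := by
    intro r
    rw [Wcx_twistCfg]
    split_ifs
    · exact (norm_ZU_sub_one N).trans ht
    · rw [Units.val_one, sub_self, norm_zero]
      exact le_trans (by positivity) ht
  exact bavg_twistCfg_not_mem hN (hG.bavg_mem (twistCfg N) (twistCfg_mem N) 0 0 hW)

/-- **In particular `SU(N)`, `N ≥ 26`, is NOT `AvgClosed`** (radius `1/4 ≥ 2π/N`): the hypothesis of
`B7Prop2Explicit.prop2Printed_concrete` fails for the paper's `G = SU(N)` with `N` large, and the `G`-dependent
radius of §3–§4 (`c₂′(d, L, SU(N))`) is genuinely needed. [cite: Balaban1985Averaging, (42) p.23, Prop. 2 p.26] -/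
theorem not_avgClosed_specialUnitary {N : ℕ} [NeZero N] (hN : 26 ≤ N) :
    ¬ AvgClosed 2 2 (specialUnitaryUnits (Fin N)) := by
  intro hG
  refine not_avgClosedAt_specialUnitary (le_trans (by norm_num) hN) ?_ (avgClosedAt_of_avgClosed hG le_rfl)
  have hNr : (26 : ℝ) ≤ N := by exact_mod_cast hN
  rw [div_le_iff₀ (by positivity)]
  have := Real.pi_lt_d2
  nlinarith

/-! ### §5b The test configuration satisfies (52) for any `N`-independent `α₀` once `N > 8π/α₀`: the tacit
`G`-valuedness of `Ū` in Prop. 2 needs a `G`-dependent threshold for `G = SU(N)` -/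

/-- `Z⁻¹ = Z⋆`, so `|Z⁻¹ − 1| = |(Z − 1)⋆| = |Z − 1| ≤ 2π/N` (matrix inverse, the `simp`-normal form of the
inverse unit). [folklore] -/
theorem norm_ZU_inv_sub_one (N : ℕ) [NeZero N] :
    ‖(ZU N : Matrix (Fin N) (Fin N) ℂ)⁻¹ - 1‖ ≤ 2 * Real.pi / N := by
  have hU : (ZU N : Matrix (Fin N) (Fin N) ℂ) ∈ unitary (Matrix (Fin N) (Fin N) ℂ) :=
    (Matrix.mem_specialUnitaryGroup_iff.1 (ZU_mem N)).1
  rw [Matrix.inv_eq_left_inv (Unitary.star_mul_self_of_mem hU), ← star_one, ← star_sub, norm_star]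
  exact norm_ZU_sub_one N

/-- **Every plaquette variable of the test configuration is `1`, `Z` or `Z⁻¹`, hence within `2π/N` of `1`:**
`sup_p |U(∂p) − 1| ≤ 2π/N` (the plaquettes through a twisted bond `⟨x, x + e₁⟩`, `x₀ = 0`, and the parallel
untwisted one at `x₀ = ±1` carry `Z^{∓1}`; all others `1`). [cite: Balaban1985Averaging, (52) p.26] -/
theorem pdev_twistCfg_le (N : ℕ) [NeZero N] : pdev (twistCfg N) ≤ 2 * Real.pi / N := by
  have h0 : (0 : ℝ) ≤ 2 * Real.pi / N := by positivity
  have hZ := norm_ZU_sub_one N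
  have hZi := norm_ZU_inv_sub_one N
  refine ciSup_le fun p => ?_
  obtain ⟨z, μ, ν⟩ := p
  dsimp only
  have h2 : z + e μ + e ν - e μ = z + e ν := by abel
  have h3 : z + e μ + e ν + -e μ - e ν = z := by abel
  simp only [plaqWord, hol_cons, hol_nil, mul_one, stepHol_true, stepHol_false, Letter.vec_true,
    Letter.vec_false, h2, h3]
  fin_cases μ <;> fin_cases ν
  · simp [twistCfg, h0]
  · by_cases hB : z 0 = 0
    · simp [twistCfg, e_apply, hB, hZi]
    · by_cases hA : z 0 = -1
      · simp [twistCfg, e_apply, hA, hZ]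
      · have hA' : z 0 + 1 ≠ 0 := by omega
        simp [twistCfg, e_apply, hA', hB, h0]
  · by_cases hB : z 0 = 0
    · simp [twistCfg, e_apply, hB, hZ]
    · by_cases hA : z 0 = -1
      · simp [twistCfg, e_apply, hA, hZi]
      · have hA' : z 0 + 1 ≠ 0 := by omega
        simp [twistCfg, e_apply, hA', hB, h0]
  · by_cases hB : z 0 = 0
    · simp [twistCfg, e_apply, hB, h0]
    · simp [twistCfg, e_apply, hB, h0]

/-- **The tacit `G`-valuedness of `Ū` in Proposition 2 needs a `G`-dependent threshold for `G = SU(N)`:** for every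
`α₀ > 0` (meant: any `N`-independent admissible constant, e.g. the printed `c₂ = min{1/(3C₀), ½c₂′}` with
"`c₂′` depends on `d` and `L`", Prop. 1 p. 26) and every `N ≥ 10` with `α₀N > 8π`, the `SU(N)`-valued configuration
`twistCfg` on `ℤ²` satisfies the hypothesis (52) of Prop. 2 with `k = 1`, `L = 2` — `sup_p |U(∂p) − 1| ≤ 2π/N <
α₀η²`, `η = L^{−k} = ½` — and yet its average `Ū = Ū¹` (43) is NOT an `SU(N)`-valued configuration: `det Ū_c = −1`
at the bond `c` of `Ω^{(1)} ≅ ℤ²` at the origin in direction `e₀`.  ((54) itself holds for it, by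
`B7Prop2Explicit.prop2Printed_unitaryGroup`, `SU(N) ⊂ U(N)`.) [cite: Balaban1985Averaging, Prop. 2 (52)–(54) p.26, Prop. 1 p.26, p.18, p.19, p.20] -/
theorem avg_not_specialUnitary_valued {N : ℕ} [NeZero N] (hN : 10 ≤ N) {α₀ : ℝ} (hα : 8 * Real.pi < α₀ * N) :
    (∀ x κ, twistCfg N x κ ∈ specialUnitaryUnits (Fin N)) ∧
      pdev (twistCfg N) < α₀ * ((((2 : ℕ) : ℝ) ^ 1)⁻¹) ^ 2 ∧
      avgIter 2 (twistCfg N) 1 0 0 ∉ specialUnitaryUnits (Fin N) := by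
  have hN0 : (0 : ℝ) < N := by exact_mod_cast Nat.pos_of_ne_zero (NeZero.ne N)
  refine ⟨twistCfg_mem N, ?_, ?_⟩
  · refine (pdev_twistCfg_le N).trans_lt ?_
    rw [div_lt_iff₀ hN0]
    norm_num
    linarith
  · rw [avgIter_succ, rescale_apply, smul_zero, avgIter_zero]
    exact bavg_twistCfg_not_mem hN

end Negative

end Literature.MathematicalPhysics.QuantumFieldTheory.Balaban1983to89.B7Prop2SpecialUnitary

end
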